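import Literature.Probability.LatticeModels.MTP2DensityFree
import HarnessLib

/-!
# Density-free cMTP₂ (Fuchs–Wang 2026, §5 (5.1)); MTP₂ of the distribution function; left-tail decrease

CITATION HEADER.  Source: S. Fuchs, Y. Wang, *An MTP₂ property for conditional distributions*, arXiv:2607.24394
(v1, 27 July 2026) [FuchsWang2026], read 2026-08-21 from the arXiv copy (lit key `paper:arxiv-2607.24394`; page numbers
are those of the preprint).  Verbatim.  p. 2: "A function `h : ℝ^d → ℝ`, `d ≥ 2`, is said to be *multivariate totally
positive of order two* (mtp₂, for short) if the inequality `h(x)h(y) ≤ h(x ∧ y)h(x ∨ y)` (1.1) holds for all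
`x, y ∈ ℝ^d` … The random vector `X` is said to be • MTP₂(X) if the distribution function of `X`, viewed as the mapping
`x ↦ P(X ≤ x)`, is mtp₂; • dMTP₂(X) if `X` has a density `f_X` with respect to the product probability measure
`⊗ P^{X_i}` and `f_X` is mtp₂."  Def. 1.1 (p. 2): "(1) Let `A` and `B` be two non-empty sets that form a partition of
`{1,2,…,d}`. The random vector `X = (X_A, X_B)` is said to be cMTP₂(X_B|X_A) if `X_A` has a density `f_{X_A}` with
respect to the product measure `⊗_{i∈A} P^{X_i}` and the mapping `(x_A, x_B) ↦ P(X_B ≤ x_B | X_A = x_A) f_{X_A}(x_A)` (1.2)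
is mtp₂."  p. 6: "• LTD(X_B|X_A), *left tail decreasing* in `A`, if the mapping (whenever it exists)
`x_A ↦ P(X_B ≤ x_B | X_A ≤ x_A)` is non-increasing for all `x_B ∈ ℝ^{|B|}`. (2.4)"  §5, p. 21 (Discussion,
"Density-free dependence concepts"): "[29] therefore introduce a density-free extension of dMTP₂ for probability measures
in terms of lattice inequalities for probabilities of Borel sets. … A possible analogue for cMTP₂ can be defined as
follows: For a partition `A, B` of `{1,2,…,d}`, the random vector `X` is said to be cMTP₂^set(X_B|X_A) if
`P(X_A ∈ C, X_B ∈ (−∞,x_B]) P(X_A ∈ D, X_B ∈ (−∞,y_B]) ≤ P(X_A ∈ C ∨ D, X_B ∈ (−∞, x_B ∨ y_B]) P(X_A ∈ C ∧ D, X_B ∈ (−∞, x_B ∧ y_B])`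
(5.1) for all `x_B, y_B ∈ ℝ^{|B|}` and all `C, D ∈ 𝓑(ℝ^{|A|})` such that `C ∨ D, C ∧ D ∈ 𝓑(ℝ^{|A|})`, where
`C ∨ D := {x ∨ y : x ∈ C, y ∈ D}`, `C ∧ D := {x ∧ y : x ∈ C, y ∈ D}`.  Establishing the equivalence between (5.1) and
(1.2) when `X_A` has a density … requires adapting the argument underlying the corresponding equivalence in [16, Theorem
3.10.14]. This adaptation, together with an analysis of closure properties under suitable modes of convergence, is left
for future research."  ([29] = Colangelo–Müller–Scarsini 2006, whose Definition 2 is the tree's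
`Literature.Probability.LatticeModels.Affiliation.mIsSetTP2`; [16] = Müller–Stoyan 2002.)

## What is here: DEFINITIONS ONLY (statement level), in the tree's vocabulary

The paper's random vector `X = (X_A, X_B)` with a partition `A, B` of the coordinates is modelled as a measure `μ` on a
product `X × Y` of two measurable lattices (`X = ℝ^A`, `Y = ℝ^B` in the paper; the partition form on `δ → α` is
`IsCMTP2SetAt`), events `{X_A ∈ C, X_B ∈ (−∞, x_B]}` being the product sets `C ×ˢ Set.Iic x_B`.

* `IsCdfMTP2 μ` — "MTP₂(X)": the distribution function `x ↦ μ(−∞, x]` is an mtp₂ function (1.1).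
* `IsCMTP2Set μ` — (5.1), cMTP₂^set(X_B|X_A), for all measurable `C, D` (the image sets `C ∧ D`, `C ∨ D` are read
  with outer measure when they are not measurable, exactly as in the tree's `mIsSetTP2`; for measurable images this is
  the printed clause).
* `IsCMTP2Box μ` — (5.1) restricted to closed order intervals `C = [a,b]`, `D = [a',b']` of `X` (then
  `C ∧ D = [a ∧ a', b ∧ b']`, `C ∨ D = [a ∨ a', b ∨ b']` on a product of chains).
* `IsLTD μ` — (2.4), LTD(X_B|X_A), in the cross-multiplied form used in the proof of Thm. 2.8 (2) (p. 7:
  "LTD(X_B|X_A) is equivalent to `P(X_A ≤ y_A, X_B ≤ x_B)P(X_A ≤ x_A, X_B ∈ ℝ^{|B|}) ≤ P(X_A ≤ x_A, X_B ≤ x_B)P(X_A ≤ y_A, X_B ∈ ℝ^{|B|})`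
  for all `x_B` and all `x_A ≤ y_A` such that `P(X_A ≤ x_A) > 0`").
* `IsCMTP2SetAt p μ` — (5.1) for a law `μ` on `δ → α` and the partition `A = {i | p i}`, `B = {i | ¬ p i}`
  (transport along `MeasurableEquiv.piEquivPiSubtypeProd`).

Deliberately NOT here: the density notions dMTP₂ / cMTP₂ (1.2) (they need a reference product measure and a version of
the conditional distribution; the tree's density layer is `Literature.Probability.LatticeModels.MTP2FourFunctions`), SI
(2.5) (a statement about versions of conditional kernels; the Sahi cell's `IsCISae` is its `|B| = 1`, `A = [i−1]`
instance on the unit cube), and every theorem ABOUT (5.1) — the paper proves none (it poses the closure question), and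
the Sahi cell's answers (box criterion, closure under weak convergence, CIS link, density comparison) are new results
that live under `Summits/CriticalPhenomena/PercolationContinuityZ3/Theorems/SahiCMTP2*.lean`.
-/

noncomputable section

namespace Literature.Probability.LatticeModels

open _root_.MeasureTheory Set
open scoped SetFamily

section Cdf

variable {Ω : Type*} [MeasurableSpace Ω] [Lattice Ω]

/-- **MTP₂ of the distribution function** ("MTP₂(X)", Fuchs–Wang p. 2 with (1.1); Karlin–Rinott's MTP₂ for the function
`x ↦ P(X ≤ x)`): `μ(−∞,x] μ(−∞,y] ≤ μ(−∞,x ∧ y] μ(−∞,x ∨ y]` for all `x, y`, on any measurable lattice.  Every measure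
satisfying Colangelo–Müller–Scarsini's Definition 2 has it (`Affiliation.mIsSetTP2.iic_mul_iic_le`).
[cite: FuchsWang2026, §1 p. 2 (MTP₂(X)) and (1.1)] -/
def IsCdfMTP2 (μ : Measure Ω) : Prop :=
  ∀ x y : Ω, μ (Iic x) * μ (Iic y) ≤ μ (Iic (x ⊓ y)) * μ (Iic (x ⊔ y))

end Cdf

section Conditional

variable {X Y : Type*} [MeasurableSpace X] [MeasurableSpace Y] [Lattice X] [Lattice Y]

/-- **Density-free cMTP₂ of the second block given the first, Fuchs–Wang's (5.1)** `cMTP₂^set(X_B|X_A)`, for a measure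
`μ` on `X × Y` (the law of `(X_A, X_B)`; `X = ℝ^A`, `Y = ℝ^B` in the paper):
`μ(C × (−∞,x]) μ(D × (−∞,y]) ≤ μ((C ∧ D) × (−∞,x ∧ y]) μ((C ∨ D) × (−∞,x ∨ y])` for all measurable `C, D ⊆ X` and all
`x, y ∈ Y`, where `C ∧ D = C ⊼ D = {c ⊓ d}`, `C ∨ D = C ⊻ D = {c ⊔ d}` (non-measurable images read with outer measure, as
in the tree's `mIsSetTP2`; the paper asks the inequality for those `C, D` whose images are Borel).
[cite: FuchsWang2026, §5 (5.1)] -/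
def IsCMTP2Set (μ : Measure (X × Y)) : Prop :=
  ∀ ⦃C D : Set X⦄, MeasurableSet C → MeasurableSet D → ∀ x y : Y,
    μ (C ×ˢ Iic x) * μ (D ×ˢ Iic y) ≤ μ ((C ⊼ D) ×ˢ Iic (x ⊓ y)) * μ ((C ⊻ D) ×ˢ Iic (x ⊔ y))

/-- **The box form of (5.1)**: Fuchs–Wang's cMTP₂^set inequality for closed order intervals `C = [a,b]`, `D = [a',b']` of
the first block, `μ([a,b] × (−∞,x]) μ([a',b'] × (−∞,y]) ≤ μ([a ∧ a', b ∧ b'] × (−∞,x ∧ y]) μ([a ∨ a', b ∨ b'] × (−∞,x ∨ y])`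
(on a product of chains `[a,b] ∧ [a',b'] = [a ∧ a', b ∧ b']` and `[a,b] ∨ [a',b'] = [a ∨ a', b ∨ b']`).
[cite: FuchsWang2026, §5 (5.1) (restricted to order intervals)] -/
def IsCMTP2Box (μ : Measure (X × Y)) : Prop :=
  ∀ (a b a' b' : X) (x y : Y),
    μ (Icc a b ×ˢ Iic x) * μ (Icc a' b' ×ˢ Iic y) ≤
      μ (Icc (a ⊓ a') (b ⊓ b') ×ˢ Iic (x ⊓ y)) * μ (Icc (a ⊔ a') (b ⊔ b') ×ˢ Iic (x ⊔ y))

/-- **Left tail decreasing in the first block, Fuchs–Wang's (2.4)** `LTD(X_B|X_A)` ("`x_A ↦ P(X_B ≤ x_B | X_A ≤ x_A)` is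
non-increasing"), in the cross-multiplied form of the proof of Thm. 2.8 (2):
`μ((−∞,y_A] × (−∞,x_B]) μ((−∞,x_A] × Y) ≤ μ((−∞,x_A] × (−∞,x_B]) μ((−∞,y_A] × Y)` for `x_A ≤ y_A`.
[cite: FuchsWang2026, (2.4) and proof of Thm. 2.8 (2), p. 7] -/
def IsLTD (μ : Measure (X × Y)) : Prop :=
  ∀ ⦃xA yA : X⦄, xA ≤ yA → ∀ xB : Y,
    μ (Iic yA ×ˢ Iic xB) * μ (Iic xA ×ˢ univ) ≤ μ (Iic xA ×ˢ Iic xB) * μ (Iic yA ×ˢ univ)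

end Conditional

section Partition

variable {δ : Type*} {α : Type*} [MeasurableSpace α] [Lattice α]

/-- **(5.1) in the paper's coordinates**: for a law `μ` of `X = (X_i)_{i ∈ δ}` on `δ → α` and the partition
`A = {i | p i}`, `B = {i | ¬ p i}` of the index set, `cMTP₂^set(X_B|X_A)` is `IsCMTP2Set` of the law of
`(X_A, X_B) = ((X_i)_{p i}, (X_i)_{¬ p i})` (transport along `MeasurableEquiv.piEquivPiSubtypeProd`).
[cite: FuchsWang2026, §5 (5.1) (partition form)] -/
def IsCMTP2SetAt (p : δ → Prop) [DecidablePred p] (μ : Measure (δ → α)) : Prop :=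
  IsCMTP2Set (μ.map (MeasurableEquiv.piEquivPiSubtypeProd (fun _ : δ => α) p))

end Partition

end Literature.Probability.LatticeModels
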